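import Summits.NavierStokesRegularity.NavierStokesRegularity.Theorems.IncrementDoorsDefs
import Summits.NavierStokesRegularity.NavierStokesRegularity.Theorems.ArgmaxNearDoorsCompositions
import HarnessLib

/-!
# IncrementDoorsCompositions — door S36-K «IncrementDoor»: the kernel-checked composition (§B3 of nsreg-p1 g30's
# `r34/Sketch36.lean` v2 sha16 f0fe6d26e287c4b8, l.835–1105 VERBATIM)

`incrementDoor_of : IncrementEngine → PointDepletion → NearFarSplit → TypeISmallFloor → IncrementDoor` (K + D + D♯ + F ⟹
S36-K) and its barrier/scale helpers (`hasDerivAt_barrier`, `sub_mul_barrier_deriv`, `hasDerivAt_modScale`, `modScale_pos`,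
`modScale_sq`, `modScale_deriv_div`, `barrier_pos`), every declaration byte-identical with the sketch; texts in
`Theorems/IncrementDoorsDefs.lean` (P0-36B).  Landed by ns-s29-p2 g4 on LEAD ns-s30-p1 g3's key 2026-08-28T17:28:24Z (c);
`--supports stmt-NavierStokesRegularity-0056 --as helper`.  K «IncrementEngine» is ON HOLD, so no closer is appended here yet.

WHAT THIS IS NOT: glue for a regularity CRITERION about hypothetical blow-up; 0056 `NoTypeII` / NS regularity NOT proved.
-/

noncomputable section

open MeasureTheory Set Function Filter Metric Real InnerProductSpace
open _root_.Topology
open scoped ENNReal NNReal RealInnerProductSpace ContDiff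
open Literature.Analysis Literature.Analysis.FluidPDE
open Literature.Analysis.FluidPDE.VorticityDirectionDynamics

set_option linter.dupNamespace false

namespace Summit.NavierStokesRegularity.NavierStokesRegularity.Theorems.IncrementDoors

open Summit.NavierStokesRegularity.NavierStokesRegularity.Theorems.ArgmaxDoors

set_option maxSynthPendingDepth 3

/-! ## §B3 Composition (kernel-checked): door S36-K from K + D + D♯ + F -/

section Composition

variable {ν T : ℝ} {u : ℝ → (EuclideanSpace ℝ (Fin 3)) → (EuclideanSpace ℝ (Fin 3))}
  {p : ℝ → (EuclideanSpace ℝ (Fin 3)) → ℝ}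

/-- The barrier amplitude is differentiable below `T` with
`B'(s) = ε/(T−s)² + c·a·(T−s)^{−a−1}`. -/
theorem hasDerivAt_barrier (T a ε c : ℝ) {s : ℝ} (hs : s < T) :
    HasDerivAt (barrier T a ε c) (ε / (T - s) ^ 2 + c * (a * (T - s) ^ (-a - 1))) s := by
  have hτs : 0 < T - s := sub_pos.2 hs
  have hlin : HasDerivAt (fun r : ℝ => T - r) (-1) s := by
    simpa using (hasDerivAt_id s).const_sub T
  have h1 : HasDerivAt (fun r : ℝ => ε / (T - r)) (ε / (T - s) ^ 2) s := by
    have h := (hlin.inv hτs.ne').const_mul ε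
    refine h.congr_of_eventuallyEq (Eventually.of_forall fun r => by simp [div_eq_mul_inv]) |>.congr_deriv ?_
    field_simp
  have h2 : HasDerivAt (fun r : ℝ => c * (T - r) ^ (-a)) (c * (a * (T - s) ^ (-a - 1))) s := by
    have h := (hlin.rpow_const (p := -a) (Or.inl hτs.ne')).const_mul c
    refine h.congr_deriv ?_
    ring
  exact h1.add h2

/-- `(T − s)·B'(s) − a·B(s) = (1 − a)ε/(T − s)` — the barrier grows STRICTLY faster than rate `a`. -/
theorem sub_mul_barrier_deriv (T a ε c : ℝ) {s : ℝ} (hs : s < T) :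
    (T - s) * (ε / (T - s) ^ 2 + c * (a * (T - s) ^ (-a - 1))) - a * barrier T a ε c s =
      (1 - a) * ε / (T - s) := by
  have hτs : 0 < T - s := sub_pos.2 hs
  unfold barrier
  have hr : (T - s) * (T - s) ^ (-a - 1) = (T - s) ^ (-a) := by
    rw [show -a = 1 + (-a - 1) by ring, Real.rpow_add hτs, Real.rpow_one]
    ring_nf
  have h2 : (T - s) * (c * (a * (T - s) ^ (-a - 1))) = c * a * (T - s) ^ (-a) := by
    rw [← hr]; ring
  rw [mul_add, h2]
  field_simp
  ring

/-- The modulus scale is differentiable below `T` with `λ'(s) = R·(−ν/(2√(ν(T−s))))`, so `λ'/λ = −1/(2(T−s))`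
and `λ² = R²ν(T−s)`. -/
theorem hasDerivAt_modScale (ν T R : ℝ) (hν : 0 < ν) {s : ℝ} (hs : s < T) :
    HasDerivAt (modScale ν T R) (R * (-ν / (2 * Real.sqrt (ν * (T - s))))) s := by
  have hτs : 0 < T - s := sub_pos.2 hs
  have hlin : HasDerivAt (fun r : ℝ => ν * (T - r)) (-ν) s := by
    simpa using ((hasDerivAt_id s).const_sub T).const_mul ν
  have h1 := (hlin.sqrt (mul_pos hν hτs).ne').const_mul R
  exact h1

/-- `λ(s) = R√(ν(T−s)) > 0` for `ν, R > 0`, `s < T`. [folklore] -/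
theorem modScale_pos {ν T R s : ℝ} (hν : 0 < ν) (hR : 0 < R) (hs : s < T) : 0 < modScale ν T R s :=
  mul_pos hR (Real.sqrt_pos.2 (mul_pos hν (sub_pos.2 hs)))

/-- `λ(s)² = R²·ν(T−s)` for `s < T`. [folklore] -/
theorem modScale_sq {ν T R s : ℝ} (hν : 0 < ν) (hs : s < T) :
    modScale ν T R s ^ 2 = R ^ 2 * (ν * (T - s)) := by
  unfold modScale
  rw [mul_pow, Real.sq_sqrt (mul_pos hν (sub_pos.2 hs)).le]

/-- the scale-shrink rate `λ′(s)/λ(s) = −1/(2(T−s))`-type identity for `λ = R√(ν(T−s))`. [folklore] -/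
theorem modScale_deriv_div {ν T R s : ℝ} (hν : 0 < ν) (hR : 0 < R) (hs : s < T) :
    R * (-ν / (2 * Real.sqrt (ν * (T - s)))) / modScale ν T R s = -1 / (2 * (T - s)) := by
  have hτs : 0 < T - s := sub_pos.2 hs
  have hq : 0 < Real.sqrt (ν * (T - s)) := Real.sqrt_pos.2 (mul_pos hν hτs)
  unfold modScale
  rw [div_eq_div_iff (mul_pos hR hq).ne' (by positivity)]
  have hsq : Real.sqrt (ν * (T - s)) * Real.sqrt (ν * (T - s)) = ν * (T - s) :=
    Real.mul_self_sqrt (mul_pos hν hτs).le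
  field_simp
  nlinarith [hsq]

/-- the barrier `ε/(T−s) + c(T−s)^{−a}` is positive for `ε > 0`, `c ≥ 0`, `s < T`. [folklore] -/
theorem barrier_pos {T a ε c s : ℝ} (hε : 0 < ε) (hc : 0 ≤ c) (hs : s < T) : 0 < barrier T a ε c s :=
  add_pos_of_pos_of_nonneg (div_pos hε (sub_pos.2 hs)) (mul_nonneg hc (Real.rpow_nonneg (sub_pos.2 hs).le _))

set_option maxHeartbeats 400000 in
/-- **Door S36-K from the plates**: `IncrementEngine → PointDepletion → NearFarSplit → TypeISmallFloor →
IncrementDoor`. For `η ∈ (0,1]` run the engine with `b = (1+η)B`, `l = λ`, margin `θ₀ = 1/(1+η)`: a breakthrough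
pair contradicts (H1) (the credits are exactly the engine's viscous and scale terms, and `(T−t)B'/B > a`); a size
touch contradicts (H2♭) through D (`α ≤ A·depletionIntegral`) and D♯ with the Lipschitz constant `b/λ` read off
the modulus (`4π(θλ)(b/λ) = 4πθ|ω(x̄)|`); so the size conjunct `‖ω(t)‖_∞ ≤ (1+η)B(t)` persists on `[t₁,T)`, and
`hasSobolevExtensionPast_of_barrier_family` ends it. -/
theorem incrementDoor_of (hK : IncrementEngine) (hD : PointDepletion) (hS : NearFarSplit)
    (hF : TypeISmallFloor) : IncrementDoor := by
  obtain ⟨A, hA, hdep⟩ := hD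
  refine ⟨A, hA, ?_⟩
  intro ν T t₁ a ε c R θ Θ Θ' Θ'' hν ht₁ ht₁T ha hε hε' hc hR hθ hprof u p hsol hreg hH0 hH1 hH2
  have hprof' := hprof
  obtain ⟨-, -, -, hΘsign, -, hΘbd, -⟩ := hprof
  -- ### the size bound `‖ω(t)‖_∞ ≤ (1+η)B(t)` on `[t₁,T)` for every `η ∈ (0,1]`
  have hsize : ∀ η : ℝ, 0 < η → η ≤ 1 → ∀ t ∈ Ico t₁ T, ∀ x,
      ‖curl (u t) x‖ ≤ (1 + η) * barrier T a ε c t := by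
    intro η hη hη1 t ht x
    have hB1 : 0 < barrier T a ε c t₁ := barrier_pos hε hc ht₁T
    rcases eq_or_lt_of_le ht.1 with h01 | h01
    · -- `t = t₁`: the size conjunct of (H0)
      rw [← h01]
      exact (hH0.2 x).trans (le_mul_of_one_le_left hB1.le (by linarith))
    -- the engine on `[t₁, t]`
    set b : ℝ → ℝ := fun s => (1 + η) * barrier T a ε c s with hb
    set b' : ℝ → ℝ := fun s => (1 + η) * (ε / (T - s) ^ 2 + c * (a * (T - s) ^ (-a - 1))) with hb'
    set l : ℝ → ℝ := modScale ν T R with hl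
    set l' : ℝ → ℝ := fun s => R * (-ν / (2 * Real.sqrt (ν * (T - s)))) with hl'
    have hslab : ∀ s ∈ Icc t₁ t, HasDerivAt b (b' s) s ∧ HasDerivAt l (l' s) s ∧ 0 < b s ∧ 0 < l s := by
      intro s hs
      have hsT : s < T := hs.2.trans_lt ht.2
      refine ⟨?_, hasDerivAt_modScale ν T R hν hsT, ?_, modScale_pos hν hR hsT⟩
      · exact (hasDerivAt_barrier T a ε c hsT).const_mul (1 + η)
      · exact mul_pos (by linarith) (barrier_pos hε hc hsT)
    have hθ₀ : 1 / (1 + η) < 1 := (div_lt_one (by linarith)).2 (by linarith)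
    have hinit : HasVorticityModulus u Θ t₁ (1 / (1 + η) * b t₁) (l t₁) := by
      have heq : 1 / (1 + η) * b t₁ = barrier T a ε c t₁ := by
        simp only [hb]; field_simp
      rw [heq]; exact hH0
    rcases hK ν T u p hν hsol hreg Θ Θ' Θ'' b b' l l' t₁ t (1 / (1 + η)) hprof' ht₁ h01 ht.2 hθ₀ hslab hinit
      with hcase | ⟨s, hs, xb, yb, hne, hmod, heqm, hK2⟩ | ⟨s, hs, xb, hmod, hmax, hsz, hK3⟩
    · -- case 1: the modulus-with-size persists up to `t`
      exact (hcase t ⟨ht.1, le_rfl⟩).2 x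
    · -- case 2: a breakthrough pair contradicts (H1)
      exfalso
      have hsT : s < T := hs.2.trans_lt ht.2
      have hτ : 0 < T - s := sub_pos.2 hsT
      have hsI : s ∈ Ioo t₁ T := ⟨hs.1, hsT⟩
      have hBs : 0 < barrier T a ε c s := barrier_pos hε hc hsT
      have hbs : b s = (1 + η) * barrier T a ε c s := rfl
      have hbpos : 0 < b s := by rw [hbs]; exact mul_pos (by linarith) hBs
      have hls : l s = modScale ν T R s := rfl
      have hlpos : 0 < l s := modScale_pos hν hR hsT
      set r : ℝ := ‖xb - yb‖ with hr
      have hr0 : 0 < r := by rw [hr]; exact norm_pos_iff.2 (sub_ne_zero.2 hne)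
      set ρ : ℝ := r / l s with hρ
      have hρ0 : 0 < ρ := div_pos hr0 hlpos
      obtain ⟨hΘρ, hΘ'ρ, -, -⟩ := hΘsign ρ hρ0
      set N : ℝ := ‖curl (u s) xb - curl (u s) yb‖ with hN
      have hNeq : N = b s * Θ ρ := heqm
      have hNpos : 0 < N := by rw [hNeq]; exact mul_pos hbpos hΘρ
      -- `Θ ρ ≤ 2` (size conjunct) and the trigger `B Θ ≤ |δω|`
      have hΘ2 : Θ ρ ≤ 2 := by
        have h1 : N ≤ ‖curl (u s) xb‖ + ‖curl (u s) yb‖ := norm_sub_le _ _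
        have h2 := hmod.2 xb
        have h3 := hmod.2 yb
        have h4 : b s * Θ ρ ≤ b s * 2 := by rw [← hNeq]; linarith
        exact le_of_mul_le_mul_left h4 hbpos
      have htrig : barrier T a ε c s * Θ ρ ≤ N := by
        rw [hNeq, hbs]
        have : 0 ≤ η * (barrier T a ε c s * Θ ρ) := mul_nonneg hη.le (mul_nonneg hBs.le hΘρ.le)
        nlinarith
      have hH1' := hH1 s hsI xb yb hne (by simpa [hρ, hr, hls] using hΘ2) (by simpa [hρ, hr, hls, hN] using htrig)
      -- names for the analytic quantities
      set X : ℝ := ⟪curl (u s) xb - curl (u s) yb,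
        fderiv ℝ (u s) xb (curl (u s) xb) - fderiv ℝ (u s) yb (curl (u s) yb)⟫ with hX
      set Tr : ℝ := |⟪u s xb - u s yb, xb - yb⟫| / r with hTr
      have hTr0 : 0 ≤ Tr := div_nonneg (abs_nonneg _) hr0.le
      -- (H1) unfolded: `(T−s)·(X/N² + Θ'ρ/(l Θρ)·Tr) ≤ a + ρΘ'/(2Θ) − 4Θ''/(R²Θ)`
      have hH1u : (T - s) * (X / N ^ 2 + Θ' ρ / (l s * Θ ρ) * |⟪u s xb - u s yb, xb - yb⟫| / r) ≤
          a + (ρ * Θ' ρ / (2 * Θ ρ) - 4 * Θ'' ρ / (R ^ 2 * Θ ρ)) := by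
        simpa [pairCharge, pairCredit, hρ, hr, hls, hN, hX] using hH1'
      -- (K2) unfolded with `l'/l = −1/(2(T−s))`, `l² = R²ν(T−s)`
      have hll : l' s / l s = -1 / (2 * (T - s)) := modScale_deriv_div hν hR hsT
      have hl2 : l s ^ 2 = R ^ 2 * (ν * (T - s)) := modScale_sq hν hsT
      have hK2u : b' s * Θ ρ - b s * Θ' ρ * ρ * (-1 / (2 * (T - s))) ≤
          4 * ν * b s * Θ'' ρ / (R ^ 2 * (ν * (T - s))) + b s * Θ' ρ / l s * |⟪u s xb - u s yb, xb - yb⟫| / r +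
            X / N := by
        have := hK2
        rw [hll, hl2] at this
        simpa [hρ, hr, hN, hX] using this
      -- clear denominators by hand
      have hP : X / N + b s * Θ' ρ / l s * |⟪u s xb - u s yb, xb - yb⟫| / r ≤
          (b s * Θ ρ / (T - s)) * (a + (ρ * Θ' ρ / (2 * Θ ρ) - 4 * Θ'' ρ / (R ^ 2 * Θ ρ))) := by
        have hfac : 0 < b s * Θ ρ / (T - s) := div_pos (mul_pos hbpos hΘρ) hτ
        have h1 := mul_le_mul_of_nonneg_left hH1u hfac.le
        have hlhs : b s * Θ ρ / (T - s) * ((T - s) * (X / N ^ 2 + Θ' ρ / (l s * Θ ρ) *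
            |⟪u s xb - u s yb, xb - yb⟫| / r)) =
            X / N + b s * Θ' ρ / l s * |⟪u s xb - u s yb, xb - yb⟫| / r := by
          rw [hNeq]
          field_simp
        rw [hlhs] at h1
        exact h1
      have hexp : (b s * Θ ρ / (T - s)) * (a + (ρ * Θ' ρ / (2 * Θ ρ) - 4 * Θ'' ρ / (R ^ 2 * Θ ρ))) =
          a * b s * Θ ρ / (T - s) + b s * Θ' ρ * ρ / (2 * (T - s)) -
            4 * ν * b s * Θ'' ρ / (R ^ 2 * (ν * (T - s))) := by
        field_simp
        ring
      have hsc : b s * Θ' ρ * ρ * (-1 / (2 * (T - s))) = -(b s * Θ' ρ * ρ / (2 * (T - s))) := by ring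
      rw [hsc] at hK2u
      rw [hexp] at hP
      have hfin : b' s * Θ ρ ≤ a * b s * Θ ρ / (T - s) := by linarith only [hK2u, hP]
      -- but `(T−s) b' > a b`
      have hgrow : a * b s < (T - s) * b' s := by
        have h := sub_mul_barrier_deriv T a ε c hsT
        have hpos : 0 < (1 - a) * ε / (T - s) := div_pos (mul_pos (by linarith) hε) hτ
        have : (T - s) * b' s - a * b s = (1 + η) * ((1 - a) * ε / (T - s)) := by
          simp only [hb, hb']; rw [← h]; ring
        have h2 : 0 < (1 + η) * ((1 - a) * ε / (T - s)) := mul_pos (by linarith) hpos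
        linarith only [this, h2]
      have hfin' : (T - s) * b' s * Θ ρ ≤ a * b s * Θ ρ := by
        have := mul_le_mul_of_nonneg_left hfin hτ.le
        rw [mul_div_cancel₀ _ hτ.ne'] at this
        linarith only [this]
      exact (not_lt.2 hfin') (mul_lt_mul_of_pos_right hgrow hΘρ)
    · -- case 3: a size touch contradicts (H2♭)
      exfalso
      have hsT : s < T := hs.2.trans_lt ht.2
      have hτ : 0 < T - s := sub_pos.2 hsT
      have hsI : s ∈ Ioo t₁ T := ⟨hs.1, hsT⟩
      have hs0 : s ∈ Ico 0 T := ⟨ht₁.trans hs.1.le, hsT⟩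
      have hBs : 0 < barrier T a ε c s := barrier_pos hε hc hsT
      have hbs : b s = (1 + η) * barrier T a ε c s := rfl
      have hbpos : 0 < b s := by rw [hbs]; exact mul_pos (by linarith) hBs
      have hls : l s = modScale ν T R s := rfl
      have hlpos : 0 < l s := modScale_pos hν hR hsT
      have hne0 : curl (u s) xb ≠ 0 := by
        rw [← norm_pos_iff, hsz]; exact hbpos
      -- D: `α − ν|∇ξ|² ≤ A·depletionIntegral − ν|∇ξ|²`
      obtain ⟨-, hDs⟩ := hdep ν T u p hsol hreg s hs0 xb hne0
      set Fr : ℝ := frobeniusNormSq (fderiv ℝ (vorticityDirection (curl (u s))) xb) with hFr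
      have hrate : ⟪vorticityDirection (curl (u s)) xb, fderiv ℝ (u s) xb (vorticityDirection (curl (u s)) xb)⟫ -
          ν * Fr ≤ A * depletionIntegral u s xb - ν * Fr := by
        refine rate_le_of_netStretch_le hne0 ?_
        unfold netStretch
        rw [← hFr]
        nlinarith [hDs]
      -- D♯ with the Lipschitz constant `b/λ` read off the modulus
      have hΛ : 0 ≤ b s / l s := (div_pos hbpos hlpos).le
      have hcoh : ∀ y, ‖y - xb‖ < θ * l s → ‖curl (u s) y - curl (u s) xb‖ ≤ b s / l s * ‖y - xb‖ := by
        intro y _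
        have h1 := hmod.1 y xb
        have h2 := (hΘbd (‖y - xb‖ / l s) (div_nonneg (norm_nonneg _) hlpos.le)).2
        calc ‖curl (u s) y - curl (u s) xb‖ ≤ b s * Θ (‖y - xb‖ / l s) := h1
          _ ≤ b s * (‖y - xb‖ / l s) := mul_le_mul_of_nonneg_left h2 hbpos.le
          _ = b s / l s * ‖y - xb‖ := by ring
      have hsplit := hS ν T u p hsol hreg s hs0 xb hne0 (θ * l s) (b s / l s) (mul_pos hθ hlpos) hΛ hcoh
      have hnear : 4 * π * (θ * l s) * (b s / l s) = 4 * π * θ * ‖curl (u s) xb‖ := by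
        rw [hsz]; field_simp
      rw [hnear] at hsplit
      -- (H2♭) at the size touch
      have htrig : barrier T a ε c s ≤ ‖curl (u s) xb‖ := by
        rw [hsz, hbs]; nlinarith
      have hH2' := hH2 s hsI xb hmax htrig
      rw [← hFr] at hH2'
      have hfar : (T - s) * (A * depletionIntegral u s xb - ν * Fr) ≤ a := by
        have h1 : A * depletionIntegral u s xb ≤
            A * (4 * π * θ * ‖curl (u s) xb‖ + farDepletionIntegral u s xb (θ * l s)) :=
          mul_le_mul_of_nonneg_left hsplit hA
        nlinarith
      -- so `b' ≤ (a/(T−s))·b`, against `(T−s)b' > ab`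
      have hK3' : (T - s) * b' s ≤ a * b s := by
        have h1 : b' s ≤ (A * depletionIntegral u s xb - ν * Fr) * b s :=
          hK3.trans (mul_le_mul_of_nonneg_right hrate hbpos.le)
        have h2 : (T - s) * b' s ≤ (T - s) * (A * depletionIntegral u s xb - ν * Fr) * b s := by
          have := mul_le_mul_of_nonneg_left h1 hτ.le
          linarith [this]
        have h3 : (T - s) * (A * depletionIntegral u s xb - ν * Fr) * b s ≤ a * b s :=
          mul_le_mul_of_nonneg_right hfar hbpos.le
        linarith
      have hgrow : a * b s < (T - s) * b' s := by
        have h := sub_mul_barrier_deriv T a ε c hsT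
        have hpos : 0 < (1 - a) * ε / (T - s) := div_pos (mul_pos (by linarith) hε) hτ
        have : (T - s) * b' s - a * b s = (1 + η) * ((1 - a) * ε / (T - s)) := by
          simp only [hb, hb']; rw [← h]; ring
        have h2 : 0 < (1 + η) * ((1 - a) * ε / (T - s)) := mul_pos (by linarith) hpos
        linarith only [this, h2]
      exact (not_lt.2 hK3') hgrow
  -- ### the common end
  refine hasSobolevExtensionPast_of_barrier_family hF hν ht₁ ha hε hε' hsol hreg fun η hη => ?_
  refine ⟨t₁, ⟨le_rfl, ht₁T⟩, c, hc, fun t ht x => ?_⟩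
  have hη' : 0 < min η 1 := lt_min hη one_pos
  have h := hsize (min η 1) hη' (min_le_right _ _) t ht x
  have hB0 : 0 ≤ barrier T a ε c t := (barrier_pos hε hc ht.2).le
  calc ‖curl (u t) x‖ ≤ (1 + min η 1) * barrier T a ε c t := h
    _ ≤ (1 + η) * barrier T a ε c t := mul_le_mul_of_nonneg_right (by linarith [min_le_left η 1]) hB0
    _ = (ε / (T - t) + c * (T - t) ^ (-a)) * (1 + η) := by unfold barrier; ring

end Composition

end Summit.NavierStokesRegularity.NavierStokesRegularity.Theorems.IncrementDoors

end
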